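import Summits.CriticalPhenomena.PercolationContinuityZ3.Theorems.PercNearOneGluingNoHeavyLowerTailOneCutFiveCondTwoPoint
import Mathlib.Tactic.Linarith
import HarnessLib

/-!
# `NoHeavyLowerTail` (stmt-CriticalPhenomena-4575), |A| = 5 glued rung: the conditional two-point row with the `Z(3,2)`
# hypothesis `Σ q > 2` in place of `q_c ≥ ½` ("V3MAX-Σ") implies `Z(3,2)`

builds on p205010 (kernel theorem, internal audit signed; external expert review pending)

Support file (prover seat `prim-quant-p1`, QUANT lane, LNT♯-EN layers; `--supports stmt-CriticalPhenomena-4575 --as helper`).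
No definitions, no named facts, no sorries; standard axioms.  Memo: `run/shared/lean/prim/quant/P1-SURPLUS.md` §11.

`OneCutFive.CondTwoPoint` (V3MAX: for distinct `o,a,b,c` with `q_c ≥ max(q_a, q_b, ½)`, `μ(B={a})·μ(B={b}) ≤ μ(B={a,c})·μ(B={b,c})`)
is FALSE (`…OneCutFivePocketHalfRefutation.not_condTwoPoint`: a five-vertex sliver at `q ≈ (.5003, .5004, .5004)`).  Its REPAIR by
the hypothesis of `Z(3,2)` itself,

  (V3MAX-Σ)  `o,a,b,c` distinct, `q_a ≤ q_c`, `q_b ≤ q_c`, `q_a + q_b + q_c > 2`  ⟹  `μ(B={a})·μ(B={b}) ≤ μ(B={a,c})·μ(B={b,c})`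

(`B = C_o ∩ {a,b,c}`, `q_v = μ(o ↔ v)`), equivalently `P(o↔c | o↔a, o↮b) + P(o↔c | o↔b, o↮a) ≥ 1`, is census-clean (this seat,
exact rationals: all graph classes on `≤ 6` vertices × 12 weight palettes, 0 / 66 660, largest ratio `0.54`; hard-constraint adversarial
climbs on 5–7 vertices, largest ratio `0.74`) and still implies `Z(3,2)`, since the tree's derivation `CondTwoPoint ⟹ Zmax ⟹ pocket ⟹ Z(3,2)`
only ever invokes V3MAX inside a `Z(3,2)` instance, where `Σ q > 2` holds.  This file records that implication with V3MAX-Σ as an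
explicit hypothesis (no `@[conjecture]` definition is introduced here; the row is stated inline in the binders).

* `OneCutFive.pocketExchange_of_condTwoPointSigma` — V3MAX-Σ ⟹ for distinct `o,a,b,c` with `q_a ≤ q_b`, `q_a ≤ q_c`, `Σ q > 2`:
  `μ(B={a}) ≤ μ(B={b,c})` (apply the row with the larger of `b, c` as the strongest vertex, then `le_of_prod_le_of_add_le`).
* `OneCutFive.zeroOneThree_of_condTwoPointSigma` — V3MAX-Σ ⟹ `ZeroOneThree` (via `zeroOneThree_of_pocketExchange`); hence also the
  glued half of oneCut(5) / the two-finger bound at a relay observer through the tree's `…_of_zeroOneThree` lemmas.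
[cite: KozmaNitzan2024, Lemma 2 (p. 6) (level 1; the level-2 rows are this programme's)]
-/

noncomputable section

namespace Summit.CriticalPhenomena.PercolationContinuityZ3.Theorems

open MeasureTheory Set Literature.Probability.LatticeModels Literature.Probability.Percolation
open scoped Classical BigOperators

namespace OneCutFive

variable {n : ℕ}

/-- **V3MAX-Σ ⟹ the pocket exchange at the weakest vertex.**  If the conditional two-point row holds under `Σ q > 2`
(hypothesis `hV`), then for distinct `o, a, b, c` with `q_a ≤ q_b`, `q_a ≤ q_c` and `q_a + q_b + q_c > 2`:
`μ(B = {a}) ≤ μ(B = {b,c})`. [this work] -/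
theorem pocketExchange_of_condTwoPointSigma
    (hV : ∀ (n : ℕ) (w : Sym2 (Fin n) → unitInterval) (o a b c : Fin n),
      o ≠ a → o ≠ b → o ≠ c → a ≠ b → a ≠ c → b ≠ c →
      (prodBernoulli w).real (openConn o a) ≤ (prodBernoulli w).real (openConn o c) →
      (prodBernoulli w).real (openConn o b) ≤ (prodBernoulli w).real (openConn o c) →
      2 < (prodBernoulli w).real (openConn o a) + (prodBernoulli w).real (openConn o b) +
        (prodBernoulli w).real (openConn o c) →
      (prodBernoulli w).real {ω : BondConfig (Fin n) | ω ∈ openConn o a ∧ ω ∉ openConn o b ∧ ω ∉ openConn o c} *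
          (prodBernoulli w).real {ω : BondConfig (Fin n) | ω ∉ openConn o a ∧ ω ∈ openConn o b ∧ ω ∉ openConn o c} ≤
        (prodBernoulli w).real {ω : BondConfig (Fin n) | ω ∈ openConn o a ∧ ω ∉ openConn o b ∧ ω ∈ openConn o c} *
          (prodBernoulli w).real {ω : BondConfig (Fin n) | ω ∉ openConn o a ∧ ω ∈ openConn o b ∧ ω ∈ openConn o c})
    (w : Sym2 (Fin n) → unitInterval) (o a b c : Fin n)
    (hoa : o ≠ a) (hob : o ≠ b) (hoc : o ≠ c) (hab : a ≠ b) (hac : a ≠ c) (hbc : b ≠ c)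
    (hqab : (prodBernoulli w).real (openConn o a) ≤ (prodBernoulli w).real (openConn o b))
    (hqac : (prodBernoulli w).real (openConn o a) ≤ (prodBernoulli w).real (openConn o c))
    (hsum : 2 < (prodBernoulli w).real (openConn o a) + (prodBernoulli w).real (openConn o b) +
      (prodBernoulli w).real (openConn o c)) :
    (prodBernoulli w).real {ω : BondConfig (Fin n) | ω ∈ openConn o a ∧ ω ∉ openConn o b ∧ ω ∉ openConn o c} ≤
      (prodBernoulli w).real {ω : BondConfig (Fin n) | ω ∉ openConn o a ∧ ω ∈ openConn o b ∧ ω ∈ openConn o c} := by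
  set μ := prodBernoulli w with hμ
  set sa := μ.real {ω : BondConfig (Fin n) | ω ∈ openConn o a ∧ ω ∉ openConn o b ∧ ω ∉ openConn o c} with hsa
  set sb := μ.real {ω : BondConfig (Fin n) | ω ∉ openConn o a ∧ ω ∈ openConn o b ∧ ω ∉ openConn o c} with hsb
  set sc := μ.real {ω : BondConfig (Fin n) | ω ∉ openConn o a ∧ ω ∉ openConn o b ∧ ω ∈ openConn o c} with hsc
  set dab := μ.real {ω : BondConfig (Fin n) | ω ∈ openConn o a ∧ ω ∈ openConn o b ∧ ω ∉ openConn o c} with hdab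
  set dac := μ.real {ω : BondConfig (Fin n) | ω ∈ openConn o a ∧ ω ∉ openConn o b ∧ ω ∈ openConn o c} with hdac
  set dbc := μ.real {ω : BondConfig (Fin n) | ω ∉ openConn o a ∧ ω ∈ openConn o b ∧ ω ∈ openConn o c} with hdbc
  have h0dab : 0 ≤ dab := measureReal_nonneg
  have h0dac : 0 ≤ dac := measureReal_nonneg
  have h0dbc : 0 ≤ dbc := measureReal_nonneg
  -- the linear relations `q_a − q_b = (sa + dac) − (sb + dbc)` and `q_a − q_c = (sa + dab) − (sc + dbc)`
  have hlin_ab : sa + dac ≤ sb + dbc := by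
    have h := real_openConn_sub μ o a b
    have h1 := real_conn_notConn_split μ o a b c
    have h2 := real_conn_notConn_split μ o b a c
    have e1 : {ω : BondConfig (Fin n) | ω ∈ openConn o b ∧ ω ∉ openConn o a ∧ ω ∉ openConn o c} =
        {ω : BondConfig (Fin n) | ω ∉ openConn o a ∧ ω ∈ openConn o b ∧ ω ∉ openConn o c} := by
      ext ω; simp only [mem_setOf_eq]; tauto
    have e2 : {ω : BondConfig (Fin n) | ω ∈ openConn o b ∧ ω ∉ openConn o a ∧ ω ∈ openConn o c} =
        {ω : BondConfig (Fin n) | ω ∉ openConn o a ∧ ω ∈ openConn o b ∧ ω ∈ openConn o c} := by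
      ext ω; simp only [mem_setOf_eq]; tauto
    rw [e1, e2] at h2
    linarith
  have hlin_ac : sa + dab ≤ sc + dbc := by
    have h := real_openConn_sub μ o a c
    have h1 := real_conn_notConn_split μ o a c b
    have h2 := real_conn_notConn_split μ o c a b
    have e0 : {ω : BondConfig (Fin n) | ω ∈ openConn o a ∧ ω ∉ openConn o c ∧ ω ∉ openConn o b} =
        {ω : BondConfig (Fin n) | ω ∈ openConn o a ∧ ω ∉ openConn o b ∧ ω ∉ openConn o c} := by
      ext ω; simp only [mem_setOf_eq]; tauto
    have e0' : {ω : BondConfig (Fin n) | ω ∈ openConn o a ∧ ω ∉ openConn o c ∧ ω ∈ openConn o b} =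
        {ω : BondConfig (Fin n) | ω ∈ openConn o a ∧ ω ∈ openConn o b ∧ ω ∉ openConn o c} := by
      ext ω; simp only [mem_setOf_eq]; tauto
    have e1 : {ω : BondConfig (Fin n) | ω ∈ openConn o c ∧ ω ∉ openConn o a ∧ ω ∉ openConn o b} =
        {ω : BondConfig (Fin n) | ω ∉ openConn o a ∧ ω ∉ openConn o b ∧ ω ∈ openConn o c} := by
      ext ω; simp only [mem_setOf_eq]; tauto
    have e2 : {ω : BondConfig (Fin n) | ω ∈ openConn o c ∧ ω ∉ openConn o a ∧ ω ∈ openConn o b} =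
        {ω : BondConfig (Fin n) | ω ∉ openConn o a ∧ ω ∈ openConn o b ∧ ω ∈ openConn o c} := by
      ext ω; simp only [mem_setOf_eq]; tauto
    rw [e0, e0'] at h1
    rw [e1, e2] at h2
    linarith
  rcases le_total (μ.real (openConn o b)) (μ.real (openConn o c)) with hle | hle
  · -- `c` is the strongest
    have hP := hV n w o a b c hoa hob hoc hab hac hbc hqac hle hsum
    exact le_of_prod_le_of_add_le h0dac h0dbc hP hlin_ab
  · -- `b` is the strongest: apply the row to `(a, c; b)`
    have hsum' : 2 < μ.real (openConn o a) + μ.real (openConn o c) + μ.real (openConn o b) := by linarith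
    have hP := hV n w o a c b hoa hoc hob hac hab hbc.symm hqab hle hsum'
    have e1 : {ω : BondConfig (Fin n) | ω ∈ openConn o a ∧ ω ∉ openConn o c ∧ ω ∉ openConn o b} =
        {ω : BondConfig (Fin n) | ω ∈ openConn o a ∧ ω ∉ openConn o b ∧ ω ∉ openConn o c} := by
      ext ω; simp only [mem_setOf_eq]; tauto
    have e2 : {ω : BondConfig (Fin n) | ω ∉ openConn o a ∧ ω ∈ openConn o c ∧ ω ∉ openConn o b} =
        {ω : BondConfig (Fin n) | ω ∉ openConn o a ∧ ω ∉ openConn o b ∧ ω ∈ openConn o c} := by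
      ext ω; simp only [mem_setOf_eq]; tauto
    have e3 : {ω : BondConfig (Fin n) | ω ∈ openConn o a ∧ ω ∉ openConn o c ∧ ω ∈ openConn o b} =
        {ω : BondConfig (Fin n) | ω ∈ openConn o a ∧ ω ∈ openConn o b ∧ ω ∉ openConn o c} := by
      ext ω; simp only [mem_setOf_eq]; tauto
    have e4 : {ω : BondConfig (Fin n) | ω ∉ openConn o a ∧ ω ∈ openConn o c ∧ ω ∈ openConn o b} =
        {ω : BondConfig (Fin n) | ω ∉ openConn o a ∧ ω ∈ openConn o b ∧ ω ∈ openConn o c} := by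
      ext ω; simp only [mem_setOf_eq]; tauto
    rw [e1, e2, e3, e4] at hP
    exact le_of_prod_le_of_add_le h0dab h0dbc hP hlin_ac

/-- **V3MAX-Σ ⟹ `Z(3,2)`** (`OneCutFive.ZeroOneThree`), via the tree's `zeroOneThree_of_pocketExchange`. [this work] -/
theorem zeroOneThree_of_condTwoPointSigma
    (hV : ∀ (n : ℕ) (w : Sym2 (Fin n) → unitInterval) (o a b c : Fin n),
      o ≠ a → o ≠ b → o ≠ c → a ≠ b → a ≠ c → b ≠ c →
      (prodBernoulli w).real (openConn o a) ≤ (prodBernoulli w).real (openConn o c) →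
      (prodBernoulli w).real (openConn o b) ≤ (prodBernoulli w).real (openConn o c) →
      2 < (prodBernoulli w).real (openConn o a) + (prodBernoulli w).real (openConn o b) +
        (prodBernoulli w).real (openConn o c) →
      (prodBernoulli w).real {ω : BondConfig (Fin n) | ω ∈ openConn o a ∧ ω ∉ openConn o b ∧ ω ∉ openConn o c} *
          (prodBernoulli w).real {ω : BondConfig (Fin n) | ω ∉ openConn o a ∧ ω ∈ openConn o b ∧ ω ∉ openConn o c} ≤
        (prodBernoulli w).real {ω : BondConfig (Fin n) | ω ∈ openConn o a ∧ ω ∉ openConn o b ∧ ω ∈ openConn o c} *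
          (prodBernoulli w).real {ω : BondConfig (Fin n) | ω ∉ openConn o a ∧ ω ∈ openConn o b ∧ ω ∈ openConn o c}) :
    ZeroOneThree :=
  zeroOneThree_of_pocketExchange fun _ w o a b c hoa hob hoc hab hac hbc hsum hqab hqac =>
    pocketExchange_of_condTwoPointSigma hV w o a b c hoa hob hoc hab hac hbc hqab hqac hsum

end OneCutFive

end Summit.CriticalPhenomena.PercolationContinuityZ3.Theorems

end
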